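import Mathlib
import HarnessLib
import Literature.MathematicalPhysics.QuantumLattice.HeatKernelGroupGaugeProofs
import Summits.Ventures.LatticeQCDFlow.Exactness.GaugeEquivariance

/-!
# Kernel coupling layers are gauge equivariant for ANY group: active link `U ↦ h(P) P⁻¹ U` with a conjugation-equivariant kernel `h` on the untraced loop `P`

HONEST FRAMING: exact (Metropolis-corrected) sampling algorithms for lattice gauge theory;
figures of merit are autocorrelation/cost numbers at stated couplings and volumes; no
continuum-physics claim.

Venture `LatticeQCDFlow` (cell pub-lqcd), topic `Exactness`; FANOUT row 10 (`eng-equiv`, engine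
`latflow.equiv`: `u1.py` (Kanwar NCP / spline PLAQUETTE couplings, `U(1)`),
`spectral.SUNSpectralCoupling` (`SU(N)`: "loop `W = U_μ(x) S(x)` with frozen `S`,
`W' = h(W | context)`, `U_μ(x)' = W' W† U_μ(x)`"), the same layers in `latflow.flows_jax`).
NEW WORK of the cell, in the vocabulary of row 30's `GaugeEquivariance.IsGaugeEquivariant` over
the tree's `GaugeConfig d L G` / `gaugeTransform` / `plaquetteHolonomy`
(`ConstructiveQFTWave0`) and `QuantumLattice.plaquetteHolonomy_gaugeTransform`; nothing is cited
as a fact; no number; no definition is introduced.  Printed counterparts, NAMED ONLY: Kanwar,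
Albergo, Boyda, Cranmer, Hackett, Racanière, Rezende, Shanahan, *Equivariant flow-based sampling
for lattice gauge theory*, PRL 125 (2020) 121601 (eqs. (11)–(13): gauge-equivariant coupling
layers from kernels on untraced loops); Boyda et al., PRD 103 (2021) 074504 §II.B–§III ("(2) Act
on these loops in a way that is equivariant under matrix conjugation; we call the function acting
in this way a kernel … thus, the whole coupling layer is gauge equivariant").

The tree already has the two extreme cases: the ABELIAN rung (`U1GaugeCovariance`: right
multiplication by an INVARIANT factor) and the `SU(2)` residual/Wilson-flow kicks
(`SU2MaskedKickEquivariance`, `SU2StapleFieldCovariance`: a Lie-algebra field transforming like a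
link).  This file is the general non-abelian statement the engine's `SU(N)` spectral coupling
instantiates (`SpectralKernelConjugation.lean` supplies its kernel's conjugation equivariance).

## Content (`G` any group, `d`, `L` any, mask `p : Edge d L → Prop` arbitrary)

* **`isGaugeEquivariant_mulLeft_of_conj_covariant`** — a layer `V e ↦ u(V, e) · V e` on active
  links whose factor transforms in the ADJOINT at the source, `u(V^g, e) = g(x) u(V, e) g(x)⁻¹`
  (`x = e.1`), is `IsGaugeEquivariant`;
* `conj_covariant_link_mul_staple` — an untraced loop `W = V e · S(V, e)` closed by a "staple"
  transforming as `S(V^g, e) = g(x + ê) S(V, e) g(x)⁻¹` transforms by conjugation at `x`;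
  `plaquetteHolonomy` is the case `S = V(x+μ̂,ν) V(x+ν̂,μ)⁻¹ V(x,ν)⁻¹` (the tree's
  `plaquetteHolonomy_gaugeTransform`);
* **`isGaugeEquivariant_kernelLayer`** — THE LAYER: for a loop field `P(V, e)` conjugation
  covariant at active links and a kernel `h(V, e) : G → G` that is gauge INVARIANT as a function
  of the configuration (it reads frozen, invariant context) and CONJUGATION EQUIVARIANT as a
  function of the loop (`h(V,e)(a b a⁻¹) = a · h(V,e)(b) · a⁻¹`) at active links, the layer
  `V e ↦ h(V,e)(P) · P⁻¹ · V e` (active), `V e` (frozen) is `IsGaugeEquivariant`;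
  **`isGaugeEquivariant_plaquetteKernelLayer`** — the case `P = plaquetteHolonomy V x μ (ν e)`
  for any choice of plane `ν e` per link (the engine's `DirectionCoupling` /
  `LocationCoupling` geometries are choices of `p` and `ν`);
* `plaquetteHolonomy_of_kernel_update` — the update SETS THE LOOP: if `V'` agrees with `V` on the
  other three links of the plaquette and `V'(x,μ) = k · P⁻¹ · V(x,μ)` then the new plaquette is
  `k` (Kanwar eq. (12): `P' = h(P)`);
* **`kernelLayer_leftInverse`** — INVERTIBILITY in the abstract: if the layer moves each active
  loop by its kernel (`P(F V, e) = h(V,e)(P(V,e))`, i.e. the loop's other links are frozen), the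
  second kernel reads the same context after the layer (`k(F V, e) = k(V, e)`) and inverts the
  first pointwise, then the `k`-layer undoes the `h`-layer: `F_k (F_h V) = V` (the engine's
  `inverse=True` pass with the algebraic spline inverse);
* instances of admissible kernels in ANY group: `isGaugeEquivariant_kernelLayer_of_comm`
  (commutative `G`: every kernel is conjugation equivariant — the `U(1)` plaquette couplings of
  Kanwar et al., any circle diffeomorphism `h` read through frozen invariant context) and
  `isGaugeEquivariant_plaquettePowerLayer` (power kernels `P ↦ P^m`, `conj_pow`; non-vacuity of
  the non-abelian hypotheses).

NOT here: the Jacobian / exactness of the layer (left/right Haar invariance reduces it to the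
kernel's, `FlowPushforward` / `Theory2.coupleEquiv`); masks making `P`'s other links and the
context frozen (hypotheses `hPF`, `hkF` are stated, not derived from a colouring); any number.
-/

namespace Summit.Ventures.LatticeQCDFlow.Exactness

open Literature.MathematicalPhysics.QuantumFieldTheory

variable {d L : ℕ}

/-! ## Any group: adjoint-covariant left factors, conjugation-covariant loops -/

section AnyGroup

variable {G : Type*} [Group G]

/-- `(V^g) e = g(x) · V e · g(x + ê)⁻¹`, by definition. -/
theorem gaugeTransform_apply (g : Site d L → G) (V : GaugeConfig d L G) (e : Edge d L) :
    gaugeTransform g V e = g e.1 * V e * (g (e.1.shift e.2))⁻¹ := rfl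

/-- **A layer multiplying each active link on the LEFT by a factor transforming in the adjoint
representation at the link's source is gauge equivariant** (any group, any mask):
`u(V^g, e) = g(x) u(V,e) g(x)⁻¹` at active `e = (x, μ)` ⟹ `V e ↦ u(V,e) · V e` is
`IsGaugeEquivariant`. -/
theorem isGaugeEquivariant_mulLeft_of_conj_covariant (p : Edge d L → Prop) [DecidablePred p]
    (u : GaugeConfig d L G → Edge d L → G)
    (hu : ∀ (g : Site d L → G) (V : GaugeConfig d L G) (e : Edge d L), p e →
      u (gaugeTransform g V) e = g e.1 * u V e * (g e.1)⁻¹) :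
    IsGaugeEquivariant (fun (V : GaugeConfig d L G) (e : Edge d L) => if p e then u V e * V e else V e) := by
  intro g V
  funext e
  by_cases he : p e
  · simp only [if_pos he, gaugeTransform_apply, hu g V e he]
    group
  · simp only [if_neg he, gaugeTransform_apply]

/-- **An untraced loop through the link transforms by conjugation at its base point.**  If the
"staple" closing the loop transforms as `S(V^g, e) = g(x + ê) · S(V, e) · g(x)⁻¹` (a path from
`x + ê` back to `x`), then `W = V e · S(V, e)` satisfies `W(V^g) = g(x) W(V) g(x)⁻¹`. -/
theorem conj_covariant_link_mul_staple (S : GaugeConfig d L G → Edge d L → G) (g : Site d L → G)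
    (V : GaugeConfig d L G) (e : Edge d L)
    (hS : S (gaugeTransform g V) e = g (e.1.shift e.2) * S V e * (g e.1)⁻¹) :
    gaugeTransform g V e * S (gaugeTransform g V) e = g e.1 * (V e * S V e) * (g e.1)⁻¹ := by
  rw [gaugeTransform_apply, hS]
  group

/-- The plaquette staple `V(x+μ̂,ν) V(x+ν̂,μ)⁻¹ V(x,ν)⁻¹` closes the link `(x, μ)` into the
plaquette holonomy: `V(x,μ) · staple = plaquetteHolonomy V x μ ν`. -/
theorem link_mul_plaquetteStaple (V : GaugeConfig d L G) (x : Site d L) (μ ν : Fin d) :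
    V (x, μ) * (V (x.shift μ, ν) * (V (x.shift ν, μ))⁻¹ * (V (x, ν))⁻¹) = plaquetteHolonomy V x μ ν := by
  simp only [plaquetteHolonomy, mul_assoc]

/-- **The plaquette through an active link transforms by conjugation at the link's source**
(the tree's `QuantumLattice.plaquetteHolonomy_gaugeTransform`, restated per edge with a plane
choice `ν e`). -/
theorem plaquetteHolonomy_edge_gaugeTransform (ν : Edge d L → Fin d) (g : Site d L → G)
    (V : GaugeConfig d L G) (e : Edge d L) :
    plaquetteHolonomy (gaugeTransform g V) e.1 e.2 (ν e) =
      g e.1 * plaquetteHolonomy V e.1 e.2 (ν e) * (g e.1)⁻¹ :=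
  Literature.MathematicalPhysics.QuantumLattice.plaquetteHolonomy_gaugeTransform g V e.1 e.2 (ν e)

/-! ## The kernel coupling layer -/

/-- **Kernel coupling layers are gauge equivariant (Kanwar et al. 2020 eqs. (11)–(13); Boyda et
al. 2021 §II.B), any group.**  Data: a mask `p` of active links; a loop field `P(V, e) ∈ G`
transforming by conjugation at the source of each active link; a kernel `h(V, e) : G → G` per
active link which, as a function of the configuration, is gauge INVARIANT (it is computed from
frozen gauge-invariant context) and, as a function of the loop, is CONJUGATION EQUIVARIANT.  Then
the layer updating each active link to `h(V,e)(P) · P⁻¹ · V e` — so that the loop becomes `h(P)`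
— and leaving frozen links alone is `IsGaugeEquivariant`. -/
theorem isGaugeEquivariant_kernelLayer (p : Edge d L → Prop) [DecidablePred p]
    (P : GaugeConfig d L G → Edge d L → G) (h : GaugeConfig d L G → Edge d L → G → G)
    (hP : ∀ (g : Site d L → G) (V : GaugeConfig d L G) (e : Edge d L), p e →
      P (gaugeTransform g V) e = g e.1 * P V e * (g e.1)⁻¹)
    (hinv : ∀ (g : Site d L → G) (V : GaugeConfig d L G) (e : Edge d L), p e →
      h (gaugeTransform g V) e = h V e)
    (hconj : ∀ (V : GaugeConfig d L G) (e : Edge d L) (a b : G), p e →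
      h V e (a * b * a⁻¹) = a * h V e b * a⁻¹) :
    IsGaugeEquivariant (fun (V : GaugeConfig d L G) (e : Edge d L) =>
      if p e then h V e (P V e) * (P V e)⁻¹ * V e else V e) := by
  have key := isGaugeEquivariant_mulLeft_of_conj_covariant p (fun V e => h V e (P V e) * (P V e)⁻¹)
    (fun g V e he => by
      rw [hinv g V e he, hP g V e he, hconj V e _ _ he]
      group)
  intro g V
  have hk := key g V
  simp only [mul_assoc] at hk ⊢
  exact hk

/-- **The plaquette kernel coupling layer is gauge equivariant**: the case
`P(V, (x, μ)) = plaquetteHolonomy V x μ (ν (x, μ))` of `isGaugeEquivariant_kernelLayer`, for any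
assignment `ν` of a plane to each link (masks / direction or location geometries are choices of
`p` and `ν`; nothing about them is needed for equivariance). -/
theorem isGaugeEquivariant_plaquetteKernelLayer (p : Edge d L → Prop) [DecidablePred p]
    (ν : Edge d L → Fin d) (h : GaugeConfig d L G → Edge d L → G → G)
    (hinv : ∀ (g : Site d L → G) (V : GaugeConfig d L G) (e : Edge d L), p e →
      h (gaugeTransform g V) e = h V e)
    (hconj : ∀ (V : GaugeConfig d L G) (e : Edge d L) (a b : G), p e →
      h V e (a * b * a⁻¹) = a * h V e b * a⁻¹) :
    IsGaugeEquivariant (fun (V : GaugeConfig d L G) (e : Edge d L) =>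
      if p e then h V e (plaquetteHolonomy V e.1 e.2 (ν e)) * (plaquetteHolonomy V e.1 e.2 (ν e))⁻¹ * V e
      else V e) :=
  isGaugeEquivariant_kernelLayer p (fun V e => plaquetteHolonomy V e.1 e.2 (ν e)) h
    (fun g V e _ => plaquetteHolonomy_edge_gaugeTransform ν g V e) hinv hconj

/-- **The update sets the loop (Kanwar et al. eq. (12): `P' = h(P)`).**  If `V'` agrees with `V`
on the three other links of the plaquette at `x` in the `(μ, ν)` plane and
`V'(x, μ) = k · P⁻¹ · V(x, μ)` with `P = plaquetteHolonomy V x μ ν`, then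
`plaquetteHolonomy V' x μ ν = k`. -/
theorem plaquetteHolonomy_of_kernel_update {V V' : GaugeConfig d L G} {x : Site d L} {μ ν : Fin d}
    (k : G) (hact : V' (x, μ) = k * (plaquetteHolonomy V x μ ν)⁻¹ * V (x, μ))
    (h1 : V' (x.shift μ, ν) = V (x.shift μ, ν)) (h2 : V' (x.shift ν, μ) = V (x.shift ν, μ))
    (h3 : V' (x, ν) = V (x, ν)) :
    plaquetteHolonomy V' x μ ν = k := by
  unfold plaquetteHolonomy at hact ⊢
  rw [hact, h1, h2, h3]
  group

/-- **Invertibility of kernel layers, abstractly.**  Two layers with the same mask and loop field,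
kernels `h` and `k`.  If the `h`-layer moves every active loop by its kernel
(`P(F V, e) = h(V,e)(P(V,e))` — the loop's other links are frozen), the kernel `k` reads the same
context after the layer (`k(F V, e) = k(V, e)`), and `k(V,e)` is a left inverse of `h(V,e)`, then
the `k`-layer undoes the `h`-layer. -/
theorem kernelLayer_leftInverse (p : Edge d L → Prop) [DecidablePred p]
    (P : GaugeConfig d L G → Edge d L → G) (h k : GaugeConfig d L G → Edge d L → G → G)
    (F Finv : GaugeConfig d L G → GaugeConfig d L G)
    (hF : ∀ V e, F V e = if p e then h V e (P V e) * (P V e)⁻¹ * V e else V e)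
    (hFinv : ∀ V e, Finv V e = if p e then k V e (P V e) * (P V e)⁻¹ * V e else V e)
    (hPF : ∀ V e, p e → P (F V) e = h V e (P V e))
    (hkF : ∀ V e, p e → k (F V) e = k V e)
    (hkh : ∀ V e a, p e → k V e (h V e a) = a) (V : GaugeConfig d L G) :
    Finv (F V) = V := by
  funext e
  rw [hFinv]
  by_cases he : p e
  · rw [if_pos he, hPF V e he, hkF V e he, hkh V e _ he, hF, if_pos he]
    group
  · rw [if_neg he, hF, if_neg he]

/-- **Power kernels**: in any group `P ↦ P ^ m` is conjugation equivariant (`conj_pow`), so the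
layer `V(x,μ) ↦ P^m P⁻¹ V(x,μ)` on any mask is gauge equivariant — the non-abelian hypotheses of
`isGaugeEquivariant_plaquetteKernelLayer` are not vacuous. -/
theorem isGaugeEquivariant_plaquettePowerLayer (p : Edge d L → Prop) [DecidablePred p]
    (ν : Edge d L → Fin d) (m : ℕ) :
    IsGaugeEquivariant (fun (V : GaugeConfig d L G) (e : Edge d L) =>
      if p e then (plaquetteHolonomy V e.1 e.2 (ν e)) ^ m * (plaquetteHolonomy V e.1 e.2 (ν e))⁻¹ * V e
      else V e) :=
  isGaugeEquivariant_plaquetteKernelLayer p ν (fun _ _ a => a ^ m) (fun _ _ _ _ => rfl)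
    (fun _ _ _ _ _ => conj_pow)

end AnyGroup

/-! ## Commutative groups: every kernel is admissible (the `U(1)` plaquette couplings) -/

section Comm

variable {G : Type*} [CommGroup G]

/-- **Abelian kernel layers (Kanwar et al. 2020, the `U(1)` flows).**  In a commutative group
conjugation equivariance is automatic, so for ANY family of maps `h(V, e) : G → G` that is gauge
invariant as a function of the configuration (e.g. a circle diffeomorphism — NCP mixture or
circular spline — whose parameters are computed from frozen plaquettes), the plaquette coupling
layer `V(x,μ) ↦ h(P) P⁻¹ V(x,μ)` is gauge equivariant. -/
theorem isGaugeEquivariant_kernelLayer_of_comm (p : Edge d L → Prop) [DecidablePred p]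
    (ν : Edge d L → Fin d) (h : GaugeConfig d L G → Edge d L → G → G)
    (hinv : ∀ (g : Site d L → G) (V : GaugeConfig d L G) (e : Edge d L), p e →
      h (gaugeTransform g V) e = h V e) :
    IsGaugeEquivariant (fun (V : GaugeConfig d L G) (e : Edge d L) =>
      if p e then h V e (plaquetteHolonomy V e.1 e.2 (ν e)) * (plaquetteHolonomy V e.1 e.2 (ν e))⁻¹ * V e
      else V e) :=
  isGaugeEquivariant_plaquetteKernelLayer p ν h hinv
    (fun V e a b _ => by rw [mul_inv_cancel_comm, mul_inv_cancel_comm])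

end Comm

end Summit.Ventures.LatticeQCDFlow.Exactness
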